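import Summits.HodgeConjecture.HodgeConjecture.Theorems.WeilTypeLadderQuadraticVariationalIff
import Summits.HodgeConjecture.HodgeConjecture.Theorems.WeilTypeLadderAnchorsOnPath
import Summits.HodgeConjecture.HodgeConjecture.Theorems.WeilTypeLadderCMReduction
import Summits.HodgeConjecture.HodgeConjecture.Theorems.WeilTypeLadderOnPath
import Summits.HodgeConjecture.HodgeConjecture.Theses.RankFourFaces
import Literature.AlgebraicGeometry.Milne1999.HodgeCMImpliesTateFiniteFields
import HarnessLib

/-!
# Ring 2 · transport — `HC_CM` + ONE CM fibre + a Weil-confined (variational / local) transport hypothesis ⟹ the Weil rungs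

HONEST FRAMING (page 1, verbatim as the cell requires):
research route conditional on HC_CM; not a corollary; Q11.4-sentence-2 already refuted in dim ≥ 3.

Cell `pub-hodge-ring2`, seat `transport` (HOME `run/shared/lean/pub/pub-hodge-ring2/`, map `RING2-MAP.md §transport`).
`HC_CM` := the tree item `Summit.HodgeConjecture.HodgeConjecture.Theses.RankFourFaces.CMAbelianHodge`
(stmt-HodgeConjecture-3052; `= ∀ A, Literature.AlgebraicGeometry.Milne1999.CMHodgeHypothesisAt A` by `Iff.rfl`),
an explicit HYPOTHESIS `(hCM : Theses.RankFourFaces.CMAbelianHodge)` of every theorem below — never a cited fact,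
never "known". Nothing in this file is asserted: the three new leaves are `@[conjecture]` definitions (Summit-side
obligations, NOT Literature facts), every theorem is an implication between named statements, and the axiom
closure of each theorem is `propext`/`Classical.choice`/`Quot.sound`.

## What "transport from CM points" can and cannot mean here

* DEAD (kernel): "CM points are dense, hence algebraicity at CM fibres spreads" —
  `Literature.AlgebraicGeometry.Markman2025.cmDensity_insufficient` (witness `ℚ ⊂ ℝ`, `√2`). Every line below
  consumes ONE CM fibre plus a GENUINE transport hypothesis of variational-Hodge type.
* DEAD in dim ≥ 3 (kernel): the weak first-order criterion of Markman's Question 11.4, sentence 2 ("Does the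
  Semi-regularity Theorem hold under the weaker assumption that `σ_E` restricts to the image of `ev_E` as an
  injective map?", arXiv:2509.23403 §11.4 — UNREFEREED preprint / ICM 2026 lecture) —
  `Literature/AlgebraicGeometry/HodgeTheory/SemiregularityWeakCriterionAbelianCounterexample{,Full}.lean`
  (sheaf `I_{F_e}` on `Θ = C^{(2)} ⊂ J(C)`, `C` general bielliptic of genus 3; every non-simple abelian variety of
  dim ≥ 3). Hence NO transport hypothesis of "(W)-criterion" type is typed here; the surviving hypotheses are of
  STRICT variational-Hodge / semiregularity type (referee checklist C5).
* SURVIVING, typed below on the carriers of the b2b `hweil` ladder (`Theorems/WeilTypeLadder*.lean`):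
  (R∞var) `WeilTypeLadder.WeilVariationalHodgeQuadratic` and (R3var) `WeilTypeLadder.WeilVariationalHodgeCMField`
  (Weil-confined variational Hodge along smooth projective Weil families — Grothendieck / Charles–Schnell
  Conj. 11.3.1 restricted to Weil classes; the hypothesis of Markman arXiv:2509.23079 Cor. 10.2.3, UNREFEREED), and
  the new, WEAKER `LocalWeilVHCAtCMQuadratic` (a Euclidean-open GERM of algebraic fibres, required ONLY at fibres
  presented by a CM abelian variety on which the class is already algebraic — exactly the output shape of the STRICT
  semiregularity theorem, Buchweitz–Flenner 2003 Thm. 5.1/5.2 = tree fact `HodgeTheory.BlochSemiregularSpread`, at a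
  semiregular representative).

## What is PROVED (kernel) — `X_of_HC_CM_…` with `HC_CM` an argument, and the on-path lemmas `X_of_HodgeConjecture`

* `mem_algebraicClasses_of_cmChart` — the ONE place `HC_CM` is consumed: on a scheme presented by a CM abelian
  variety `A₀ ≅ X`, every rational `(p,p)` class is algebraic (transport of the three predicates along `e₀`,
  `HodgeTheory/IsoTransport`; smooth projectivity of `A₀` is the tree's theorem `AbelianVariety.isSmoothProjective_holds`).
* `anchoredWeilFamiliesQuadratic_of_HC_CM_of_cmPointed` / `anchoredWeilFamiliesCMField_of_HC_CM_of_cmPointed` —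
  under `HC_CM`, a Weil family through `c` with a CM-charted fibre IS an anchored family (R∞anc / R3anc).
* `HC_WeilClassesQuadratic_of_HC_CM` : `HC_CM → CMPointedWeilFamiliesQuadratic → WeilVariationalHodgeQuadratic →
  WeilClassesImaginaryQuadratic` (R∞: Weil's 1977 question for every imaginary quadratic `K`, every `n ≥ 2`, every
  discriminant), and its LOCAL form `HC_WeilClassesQuadratic_of_HC_CM_local` with `LocalWeilVHCAtCMQuadratic` in
  place of R∞var (Baire + Charles–Schnell Prop. 11.3.11 over the smooth irreducible quasi-projective base, tree lemma
  `mem_algebraicClasses_of_isOpen_subset_algebraicityLocus`).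
* `HC_WeilClassesCMField_of_HC_CM` : `HC_CM → CMPointedWeilFamiliesCMField → WeilVariationalHodgeCMField →
  WeilClassesCMField` (R3, CM fields of degree `> 2` — the case Markman's §12 leaves open).
* Corollaries into ledger items by the tree's arrows (`Theorems/WeilTypeLadderOnPath.lean`):
  `HC_WeilClassesAlgebraic_of_HC_CM` (stmt-HodgeConjecture-2522 `TropicalCuspLift.WeilClassesAlgebraic`),
  `HC_WeilSixfolds_of_HC_CM` (stmt-2524 `SevenfoldWeilCensus.WeilSixfolds`), `HC_SplitWeil_of_HC_CM` (R2).
* `HC_CM_iff_weilRungs_of_andre_of_transport` — granted André 1992 (tree fact, direction Weil ⟹ CM ONLY) and the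
  four transport leaves, `HC_CM ↔ R∞ ∧ R3`.
* On-path (C6): the targets are cases of the summit by the TREE's landed lemmas (not restated here — dedup):
  `WeilTypeLadder.weilClassesImaginaryQuadratic_of_hodgeConjecture` (R∞), `weilClassesCMField_of_hodgeConjecture` (R3),
  `weilSixfolds_of_hodgeConjecture` (stmt-2524), `splitWeilAbelianVarieties_of_hodgeConjecture` (R2); new here:
  `HC_WeilClassesAlgebraic_of_HodgeConjecture` (stmt-2522), `localWeilVHCAtCMQuadratic_of_hodgeConjecture`,
  `localWeilVHCAtCMQuadratic_of_weilVariationalHodgeQuadratic` (the local-at-CM leaf is weaker than R∞var),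
  `HC_CM_of_HodgeConjecture`. The two CM-POINTED leaves are moduli
  statements (existence of a Weil family through `c` containing a CM fibre: Weil 1977 / Deligne–Milne LNM 900 §4
  moduli of Weil type + Deligne's global invariant cycles + density of CM points, Mumford 1969) and are NOT cases of
  HC; they carry no on-path lemma and are recorded as typed missing inputs.

## What is NOT reached (recorded as owed rows of RING2-MAP.md §transport, not typed here)

`HC_WeilType_of_HC_CM` for ALL Hodge classes on a Weil-type abelian variety needs "Hodge ring generated by divisors
and Weil classes" (Weil 1977; Moonen–Zarhin 1998) plus cup-closure of algebraic classes, neither in the tree in that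
generality; `HC_AV_of_HC_CM` is the tree's CM pivot (`Theorems/PadicSemiregularLiftHodgeAbelianVarietiesCMPivot*`,
`hodgeAbelianVarieties_of_cmAbelianHodge_of_cmAnchoredFamilies_of_localVHCAtCM`) and is cited there, not re-proved.
Markman's own theorems (arXiv:2502.03415 Thm. 1.5.1, UNREFEREED; survey Thm. 1.2) use NO CM input: the anchor is a
genus-3 product point `X × X̂` with a `G`-equivariantly semiregular secant sheaf, `K` imaginary quadratic, `n = 3`
split (discriminant the coset of `-1`), `n = 2` all discriminants by Schoen's product trick (§11.5 Step 2).
-/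

set_option linter.dupNamespace false

noncomputable section

open CategoryTheory

namespace Summit.HodgeConjecture.HodgeConjecture.Ring2Transport

open Literature.AlgebraicGeometry Literature.AlgebraicGeometry.Motives
open Literature.AlgebraicGeometry.HodgeTheory
open Literature.AlgebraicTopology.SingularHomology
open Literature.AlgebraicGeometry.Milne1999 (IsOfCMType)
open Summit.HodgeConjecture.HodgeConjecture.WeilTypeLadder
open Summit.HodgeConjecture.HodgeConjecture.Theses

/-! ### §0 The binding of `HC_CM` and the one lemma that consumes it -/

/-- `HC_CM` as bound by this cell is, pointwise, Milne's hypothesis (H) of Thm. 7.1: the route item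
`RankFourFaces.CMAbelianHodge` is `∀ A, CMHodgeHypothesisAt A` by `Iff.rfl`. [cite: Milne1999, §7 p. 72] -/
theorem HC_CM_iff_forall_cmHodgeHypothesisAt :
    Theses.RankFourFaces.CMAbelianHodge ↔
      ∀ A : Motives.AbelianVariety ℂ, Literature.AlgebraicGeometry.Milne1999.CMHodgeHypothesisAt A :=
  Iff.rfl

/-- **`HC_CM` at a CM chart.** If `X` is presented by a CM abelian variety `e₀ : A₀.X ≅ X` of dimension `N`,
then under `HC_CM` every rational class of Hodge type `(p,p)` in `H²ᵖ(X(ℂ); ℂ)` is algebraic: `A₀` is smooth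
projective of dimension `A₀.dim` (tree theorem `AbelianVariety.isSmoothProjective_holds`), `HC_CM` gives
`HodgeConjectureFor A₀.dim A₀.X`, and rationality, Hodge type and algebraicity travel along `e₀`
(`HodgeTheory/IsoTransport`). This is the ONLY place the hypothesis `HC_CM` is used in this file.
[cite: Milne1999, §7 p. 72] [cite: SerreGAGA1956, §2] -/
theorem mem_algebraicClasses_of_cmChart (hCM : Theses.RankFourFaces.CMAbelianHodge)
    {X : Motives.SchemeOver ℂ} {N p : ℕ} (A₀ : Motives.AbelianVariety ℂ) (e₀ : A₀.X ≅ X)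
    (hA₀dim : A₀.dim = N) (hA₀cm : IsOfCMType A₀)
    {x : complexBetti X (2 * p)} (hxQ : IsRationalClass x) (hxH : IsOfHodgeType N X (2 * p) p p x) :
    x ∈ algebraicClasses X p := by
  have hHC : HodgeConjectureFor A₀.dim A₀.X :=
    hCM A₀ (AbelianVariety.isSmoothProjective_holds (A := A₀)) hA₀cm
  subst hA₀dim
  exact (mem_algebraicClasses_map_iff_of_iso e₀).1
    (hHC.2 p _ ((isRationalClass_map_iff_of_iso e₀).2 hxQ) ((isOfHodgeType_map_iff_of_iso e₀).2 hxH))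

/-- ON-PATH: `HC_CM` is a case of the summit. [cite: Deligne2000, §1] -/
theorem HC_CM_of_HodgeConjecture (h : _root_.HodgeConjecture) : Theses.RankFourFaces.CMAbelianHodge :=
  fun _ hX _ ↦ h hX

/-! ### §1 The CM-POINTED family leaves (anchor supply with a CM fibre instead of an algebraic fibre) -/

/-- **CM-pointed Weil families, imaginary quadratic `K = ℚ(√-d)` (typed missing input; Summit-side leaf, NOT a
Literature fact).** VERBATIM the anchored leaf R∞anc `WeilTypeLadder.AnchoredWeilFamiliesQuadratic` with its last
conjunct "`W|_{𝒳_{s₀}}` is algebraic" REPLACED by "`𝒳_{s₀}` is presented by a CM abelian variety of dimension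
`2n`" (`Milne1999.IsOfCMType`: a reduced commutative `ℚ`-subalgebra of `End⁰` of rank `2·dim`). For `n ≥ 2`,
`d ≥ 1`, `(A, φ)` an abelian `2n`-fold with `φ ≫ φ = -(d • 𝟙 A)` and a rational `(n,n)` Weil class `c ≠ 0`:
a smooth projective family `f : 𝒳 ⟶ S` of relative dimension `2n` (`𝒳`, `S` quasi-projective, `S` smooth
irreducible), `s₁ s₀ : S(ℂ)`, `ι : A.X ≅ 𝒳_{s₁}`, a global `W ∈ H^{2n}(𝒳(ℂ); ℂ)` fibrewise rational of type
`(n,n)` and carried by charts into the Weil planes, `ι^*(W|_{𝒳_{s₁}}) = c`, and a CM chart at `s₀`. In print: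
the connected component through `(A, φ, polarisation)` of Weil's moduli space of polarized abelian `2n`-folds of
Weil type (Weil 1977; Deligne–Milne, LNM 900 §4), its universal family over a level cover, the flat Weil
section lifted to a global class by Deligne's global invariant cycle theorem, and ONE point of CM type on the
component (CM points are dense in Hodge-type families: Mumford 1969 §3). OPEN as a formal statement of the tree
(no moduli space of Weil type is constructed in `Literature/`); NOT a case of HC (HC supplies algebraic, not CM,
fibres), so it carries no on-path lemma. Under `HC_CM` it implies R∞anc
(`anchoredWeilFamiliesQuadratic_of_HC_CM_of_cmPointed`). [cite: Weil1977HodgeRing, pp. 421–429]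
[cite: Deligne1982HodgeCycles, §4, proof of Thm. 4.8 (a)–(c) and §5] [cite: Mumford1969NoteShimura, §3]
[cite: Markman2025SecantWeil, §2.4 and Lemma 3.1.3 (preprint, unrefereed)] [status: open] -/
@[conjecture] def CMPointedWeilFamiliesQuadratic : Prop :=
  ∀ (n : ℕ), 2 ≤ n → ∀ (d : ℕ), 0 < d → ∀ (A : Motives.AbelianVariety ℂ) (φ : A ⟶ A), A.dim = 2 * n →
    Motives.IsSmoothProjective (2 * n) A.X → φ ≫ φ = -(d • 𝟙 A) →
      ∀ c : complexBetti A.X (2 * n), IsRationalClass c → IsOfHodgeType (2 * n) A.X (2 * n) n n c →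
        c ∈ weilClassesOf A φ n d → c ≠ 0 →
        ∃ (𝒳 S : Motives.SchemeOver ℂ) (f : 𝒳 ⟶ S) (s₁ s₀ : Motives.ComplexPoints S)
            (ι : A.X ≅ Motives.fiberOver f s₁) (W : complexBetti 𝒳 (2 * n)),
          Motives.IsSmoothProjectiveFamily f (2 * n) ∧ IsQuasiProjectiveOver 𝒳 ∧ IsQuasiProjectiveOver S ∧
          IrreducibleSpace S.left ∧ AlgebraicGeometry.Smooth S.hom ∧
          (∀ s : Motives.ComplexPoints S,
            IsRationalClass (complexBetti.map (Motives.fiberι f s) (2 * n) W) ∧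
              IsOfHodgeType (2 * n) (Motives.fiberOver f s) (2 * n) n n
                (complexBetti.map (Motives.fiberι f s) (2 * n) W)) ∧
          (∀ s : Motives.ComplexPoints S, ∃ (A' : Motives.AbelianVariety ℂ) (φ' : A' ⟶ A')
              (e' : A'.X ≅ Motives.fiberOver f s),
            A'.dim = 2 * n ∧ φ' ≫ φ' = -(d • 𝟙 A') ∧
              complexBetti.map e'.hom (2 * n) (complexBetti.map (Motives.fiberι f s) (2 * n) W) ∈
                weilClassesOf A' φ' n d) ∧
          complexBetti.map ι.hom (2 * n) (complexBetti.map (Motives.fiberι f s₁) (2 * n) W) = c ∧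
          ∃ A₀ : Motives.AbelianVariety ℂ,
            Nonempty (A₀.X ≅ Motives.fiberOver f s₀) ∧ A₀.dim = 2 * n ∧ IsOfCMType A₀

/-- **CM-pointed Weil families, CM field `K = ℚ[T]/(P)` of degree `e > 2` (typed missing input; Summit-side leaf,
NOT a Literature fact).** VERBATIM the anchored leaf R3anc `WeilTypeLadder.AnchoredWeilFamiliesCMField` with its
last conjunct "`W|_{𝒳_{s₀}}` is algebraic" REPLACED by "`𝒳_{s₀}` is presented by a CM abelian variety of
dimension `e·m`". In print: Deligne–Milne's moduli of polarized abelian varieties of Weil type for a CM field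
(LNM 900 §4; Markman arXiv:2509.23079 §9.2 period domains `Ω_{B,t}`, UNREFEREED), global invariant cycles, and one CM
point on the component (Mumford 1969). OPEN as a formal statement of the tree; NOT a case of HC; no on-path lemma.
Under `HC_CM` it implies R3anc (`anchoredWeilFamiliesCMField_of_HC_CM_of_cmPointed`).
[cite: Deligne1982HodgeCycles, §4, proof of Thm. 4.8 (a)–(c) and §5] [cite: Mumford1969NoteShimura, §3]
[cite: Markman2025SecantRealMultiplication, §9.2 and Cor. 10.2.3 (preprint, unrefereed)] [status: open] -/
@[conjecture] def CMPointedWeilFamiliesCMField : Prop :=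
  ∀ (A : Motives.AbelianVariety ℂ) (φ : A ⟶ A) (P : Polynomial ℤ) (e m : ℕ),
    P.Monic → P.natDegree = e → 2 < e → Irreducible (P.map (Int.castRingHom ℚ)) →
    Polynomial.eval₂ (Int.castRingHom (CategoryTheory.End A)) (φ : CategoryTheory.End A) P = 0 →
    e * (2 * m) = 2 * A.dim →
    (∀ ρ : ℂ, Polynomial.eval₂ (Int.castRingHom ℂ) ρ P = 0 → starRingEnd ℂ ρ ≠ ρ) →
    (∃ Q : Polynomial ℚ, ∀ ρ : ℂ, Polynomial.eval₂ (Int.castRingHom ℂ) ρ P = 0 →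
        Polynomial.eval₂ (algebraMap ℚ ℂ) ρ Q = starRingEnd ℂ ρ) →
      ∀ c ∈ weilClassesField A φ P (2 * m), IsRationalClass c →
        IsOfHodgeType A.dim A.X (2 * m) m m c → c ≠ 0 →
        ∃ (𝒳 S : Motives.SchemeOver ℂ) (f : 𝒳 ⟶ S) (s₁ s₀ : Motives.ComplexPoints S)
            (ι : A.X ≅ Motives.fiberOver f s₁) (W : complexBetti 𝒳 (2 * m)),
          Motives.IsSmoothProjectiveFamily f (e * m) ∧ IsQuasiProjectiveOver 𝒳 ∧ IsQuasiProjectiveOver S ∧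
          IrreducibleSpace S.left ∧ AlgebraicGeometry.Smooth S.hom ∧
          (∀ s : Motives.ComplexPoints S,
            IsRationalClass (complexBetti.map (Motives.fiberι f s) (2 * m) W) ∧
              IsOfHodgeType (e * m) (Motives.fiberOver f s) (2 * m) m m
                (complexBetti.map (Motives.fiberι f s) (2 * m) W)) ∧
          (∀ s : Motives.ComplexPoints S, ∃ (A' : Motives.AbelianVariety ℂ) (φ' : A' ⟶ A')
              (e' : A'.X ≅ Motives.fiberOver f s),
            Polynomial.eval₂ (Int.castRingHom (CategoryTheory.End A')) (φ' : CategoryTheory.End A') P = 0 ∧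
              e * (2 * m) = 2 * A'.dim ∧
              complexBetti.map e'.hom (2 * m) (complexBetti.map (Motives.fiberι f s) (2 * m) W) ∈
                weilClassesField A' φ' P (2 * m)) ∧
          complexBetti.map ι.hom (2 * m) (complexBetti.map (Motives.fiberι f s₁) (2 * m) W) = c ∧
          ∃ A₀ : Motives.AbelianVariety ℂ,
            Nonempty (A₀.X ≅ Motives.fiberOver f s₀) ∧ A₀.dim = e * m ∧ IsOfCMType A₀

/-- **Under `HC_CM`, a CM-pointed Weil family is an anchored Weil family** (imaginary quadratic `K`):
`HC_CM → CMPointedWeilFamiliesQuadratic → AnchoredWeilFamiliesQuadratic` — the CM fibre `𝒳_{s₀} ≅ A₀.X` carries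
the rational `(n,n)` class `W|_{𝒳_{s₀}}`, algebraic by `mem_algebraicClasses_of_cmChart`.
[cite: Deligne1982HodgeCycles, proof of Thm. 4.8 (a)–(c)] -/
theorem anchoredWeilFamiliesQuadratic_of_HC_CM_of_cmPointed (hCM : Theses.RankFourFaces.CMAbelianHodge)
    (hP : CMPointedWeilFamiliesQuadratic) : AnchoredWeilFamiliesQuadratic := by
  intro n hn d hd A φ hAdim hX hφ c hcQ hcH hc hc0
  obtain ⟨𝒳, S, f, s₁, s₀, ι, W, hf, h𝒳, hS, hirrS, hsm, hW, hWeil, hread, A₀, ⟨e₀⟩, hA₀dim, hA₀cm⟩ :=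
    hP n hn d hd A φ hAdim hX hφ c hcQ hcH hc hc0
  exact ⟨𝒳, S, f, s₁, s₀, ι, W, hf, h𝒳, hS, hirrS, hsm, hW, hWeil, hread,
    mem_algebraicClasses_of_cmChart hCM A₀ e₀ hA₀dim hA₀cm (hW s₀).1 (hW s₀).2⟩

/-- **Under `HC_CM`, a CM-pointed Weil family is an anchored Weil family** (CM field of degree `> 2`):
`HC_CM → CMPointedWeilFamiliesCMField → AnchoredWeilFamiliesCMField`.
[cite: Deligne1982HodgeCycles, proof of Thm. 4.8 (a)–(c)] -/
theorem anchoredWeilFamiliesCMField_of_HC_CM_of_cmPointed (hCM : Theses.RankFourFaces.CMAbelianHodge)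
    (hP : CMPointedWeilFamiliesCMField) : AnchoredWeilFamiliesCMField := by
  intro A φ P e m hPm hPe he hirr hφ hdim hnr hQ c hc hcQ hcH hc0
  obtain ⟨𝒳, S, f, s₁, s₀, ι, W, hf, h𝒳, hS, hirrS, hsm, hW, hWeil, hread, A₀, ⟨e₀⟩, hA₀dim, hA₀cm⟩ :=
    hP A φ P e m hPm hPe he hirr hφ hdim hnr hQ c hc hcQ hcH hc0
  exact ⟨𝒳, S, f, s₁, s₀, ι, W, hf, h𝒳, hS, hirrS, hsm, hW, hWeil, hread,
    mem_algebraicClasses_of_cmChart hCM A₀ e₀ hA₀dim hA₀cm (hW s₀).1 (hW s₀).2⟩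

/-! ### §2 The conditional theorems with the GLOBAL Weil-confined variational hypothesis (R∞var / R3var) -/

/-- **`HC_WeilClassesQuadratic_of_HC_CM` — Weil's question for every imaginary quadratic `K` (rung R∞:
every `n ≥ 2`, every `d ≥ 1`, every discriminant) from `HC_CM`, CM-pointed Weil families and Weil-confined
variational Hodge.** `HC_CM` makes the CM fibre an algebraic anchor; R∞var transports algebraicity to `𝒳_{s₁}`;
read back along `ι` (tree glue `weilClassesImaginaryQuadratic_of_anchored_of_variational`). CONDITIONAL on all three
named hypotheses; ON-PATH lemma of the target = tree `WeilTypeLadder.weilClassesImaginaryQuadratic_of_hodgeConjecture`.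
The formal analogue, with a CM-type anchor, of Markman's "reduction of the algebraicity of the Weil classes … to the
variational Hodge conjecture" (arXiv:2509.23079 Cor. 10.2.3, preprint, unrefereed).
[cite: Markman2025SecantRealMultiplication, Cor. 10.2.3 (preprint, unrefereed)] [cite: CharlesSchnell2014Notes, Conj. 11.3.1 (p. 477)] -/
theorem HC_WeilClassesQuadratic_of_HC_CM (hCM : Theses.RankFourFaces.CMAbelianHodge)
    (hP : CMPointedWeilFamiliesQuadratic) (hV : WeilVariationalHodgeQuadratic) :
    WeilClassesImaginaryQuadratic :=
  weilClassesImaginaryQuadratic_of_anchored_of_variational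
    (anchoredWeilFamiliesQuadratic_of_HC_CM_of_cmPointed hCM hP) hV

/-- **`HC_WeilClassesCMField_of_HC_CM` — the Weil classes for CM fields `K` of degree `> 2` (rung R3, the case
§12 of the survey leaves open) from `HC_CM`, CM-pointed `K`-Weil families and Weil-confined variational Hodge for
`K`** (tree glue `weilClassesCMField_of_anchored_of_variational`). CONDITIONAL on all three named hypotheses;
ON-PATH lemma of the target = tree `WeilTypeLadder.weilClassesCMField_of_hodgeConjecture`.
[cite: Markman2025SecantRealMultiplication, Thm. 1.1.2 and Cor. 10.2.3 (preprint, unrefereed)]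
[cite: Markman2025SurveySecant, §12 (preprint / ICM 2026 lecture, unrefereed)] -/
theorem HC_WeilClassesCMField_of_HC_CM (hCM : Theses.RankFourFaces.CMAbelianHodge)
    (hP : CMPointedWeilFamiliesCMField) (hV : WeilVariationalHodgeCMField) : WeilClassesCMField :=
  weilClassesCMField_of_anchored_of_variational (anchoredWeilFamiliesCMField_of_HC_CM_of_cmPointed hCM hP) hV

/-! ### §3 The sharper surviving hypothesis: a LOCAL germ of algebraic fibres, required only at CM-charted algebraic fibres -/

/-- **LOCAL Weil-confined variational Hodge AT CM FIBRES, imaginary quadratic `K` (typed missing input; the weakest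
transport hypothesis this file can use; Summit-side leaf, NOT a Literature fact).** In the binders of R∞var
(`WeilTypeLadder.WeilVariationalHodgeQuadratic`: `n ≥ 2`, `d ≥ 1`, smooth projective `ℚ(√-d)`-Weil family
`f : 𝒳 ⟶ S` of relative dimension `2n`, `𝒳`, `S` quasi-projective, `S` smooth irreducible, global `W` fibrewise
rational of type `(n,n)` in the Weil planes through charts): for every complex point `s₀` whose fibre is PRESENTED BY A
CM ABELIAN VARIETY of dimension `2n` and on which `W|_{𝒳_{s₀}}` is ALGEBRAIC, there is a Euclidean-open `U ∋ s₀` in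
`S(ℂ)` with `W|_{𝒳_t}` algebraic for all `t ∈ U`. This is exactly the OUTPUT SHAPE of the STRICT semiregularity
theorem (Bloch 1972; Buchweitz–Flenner 2003 Thm. 5.1/5.2; tree fact `HodgeTheory.BlochSemiregularSpread (2n) n`)
at a semiregular representative of the algebraic class on the CM fibre — NOT the weak criterion (W) of Question 11.4
sentence 2, which is refuted in dim ≥ 3 (`SemiregularityWeakCriterionAbelianCounterexample`). WEAKER than R∞var
(`localWeilVHCAtCMQuadratic_of_weilVariationalHodgeQuadratic`); a CASE of the summit
(`localWeilVHCAtCMQuadratic_of_hodgeConjecture`). OPEN. [cite: BuchweitzFlenner2003, Thm. 5.1 and Thm. 5.2]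
[cite: Bloch1972Semiregularity, Introduction and Remark (7.5)] [cite: CharlesSchnell2014Notes, Conj. 11.3.1 and Prop. 11.3.11]
[cite: Markman2025SurveySecant, Question 11.4 and §12 (preprint / ICM 2026 lecture, unrefereed)] [status: open] -/
@[conjecture] def LocalWeilVHCAtCMQuadratic : Prop :=
  ∀ (n : ℕ), 2 ≤ n → ∀ (d : ℕ), 0 < d →
    ∀ ⦃𝒳 S : Motives.SchemeOver ℂ⦄ (f : 𝒳 ⟶ S), Motives.IsSmoothProjectiveFamily f (2 * n) →
      IsQuasiProjectiveOver 𝒳 → IsQuasiProjectiveOver S → IrreducibleSpace S.left →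
      AlgebraicGeometry.Smooth S.hom →
      ∀ (W : complexBetti 𝒳 (2 * n)),
        (∀ s : Motives.ComplexPoints S,
          IsRationalClass (complexBetti.map (Motives.fiberι f s) (2 * n) W) ∧
            IsOfHodgeType (2 * n) (Motives.fiberOver f s) (2 * n) n n
              (complexBetti.map (Motives.fiberι f s) (2 * n) W)) →
        (∀ s : Motives.ComplexPoints S, ∃ (A' : Motives.AbelianVariety ℂ) (φ' : A' ⟶ A')
            (e' : A'.X ≅ Motives.fiberOver f s),
          A'.dim = 2 * n ∧ φ' ≫ φ' = -(d • 𝟙 A') ∧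
            complexBetti.map e'.hom (2 * n) (complexBetti.map (Motives.fiberι f s) (2 * n) W) ∈
              weilClassesOf A' φ' n d) →
        ∀ s₀ : Motives.ComplexPoints S,
          (∃ A₀ : Motives.AbelianVariety ℂ,
              Nonempty (A₀.X ≅ Motives.fiberOver f s₀) ∧ A₀.dim = 2 * n ∧ IsOfCMType A₀) →
          complexBetti.map (Motives.fiberι f s₀) (2 * n) W ∈ algebraicClasses (Motives.fiberOver f s₀) n →
          ∃ U : Set (Motives.ComplexPoints S), IsOpen U ∧ s₀ ∈ U ∧
            ∀ t ∈ U, complexBetti.map (Motives.fiberι f t) (2 * n) W ∈ algebraicClasses (Motives.fiberOver f t) n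

/-- ON-PATH (C6): `LocalWeilVHCAtCMQuadratic` is a case of the summit (`U = S(ℂ)`: every fibre is smooth
projective of dimension `2n` and `W|_{𝒳_t}` is a rational `(n,n)` class). [cite: CharlesSchnell2014Notes, Cor. 11.3.6 (p. 479)] -/
theorem localWeilVHCAtCMQuadratic_of_hodgeConjecture (h : _root_.HodgeConjecture) : LocalWeilVHCAtCMQuadratic :=
  fun n _ _ _ _ _ _ hf _ _ _ _ _ hW _ s₀ _ _ ↦
    ⟨Set.univ, isOpen_univ, Set.mem_univ s₀, fun t _ ↦ (h (hf.isSmoothProjective t)).2 n _ (hW t).1 (hW t).2⟩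

/-- `LocalWeilVHCAtCMQuadratic` is WEAKER than the global leaf R∞var (`U = S(ℂ)`, the CM chart unused).
[cite: CharlesSchnell2014Notes, Conj. 11.3.1 (p. 477)] -/
theorem localWeilVHCAtCMQuadratic_of_weilVariationalHodgeQuadratic (hV : WeilVariationalHodgeQuadratic) :
    LocalWeilVHCAtCMQuadratic :=
  fun n hn d hd _ _ f hf h𝒳 hS hirrS hsm W hW hWeil s₀ _ hs₀ ↦
    ⟨Set.univ, isOpen_univ, Set.mem_univ s₀,
      fun t _ ↦ hV n hn d hd f hf h𝒳 hS hirrS hsm W hW hWeil ⟨s₀, hs₀⟩ t⟩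

/-- **`HC_WeilClassesQuadratic_of_HC_CM_local` — R∞ from `HC_CM`, CM-pointed Weil families and the LOCAL germ at
CM fibres.** `HC_CM` makes `W|_{𝒳_{s₀}}` algebraic on the CM fibre; the local leaf gives a Euclidean-open `U ∋ s₀` of
algebraic fibres; Baire + Charles–Schnell over the smooth irreducible quasi-projective base (tree lemma
`mem_algebraicClasses_of_isOpen_subset_algebraicityLocus`) makes EVERY fibre algebraic, in particular `𝒳_{s₁} ≅ A.X`;
read back along `ι`. CONDITIONAL on all three named hypotheses. This is the precise "CM point ⟹ whole family"
principle that survives the refutation of Question 11.4 sentence 2: one CM fibre, STRICT-semiregularity-shaped local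
output, analytic continuation of the algebraicity locus.
[cite: CharlesSchnell2014Notes, Prop. 11.3.11 (proof)] [cite: BuchweitzFlenner2003, Thm. 5.1]
[cite: Markman2025SurveySecant, §2 and §12 (preprint / ICM 2026 lecture, unrefereed)] -/
theorem HC_WeilClassesQuadratic_of_HC_CM_local (hCM : Theses.RankFourFaces.CMAbelianHodge)
    (hP : CMPointedWeilFamiliesQuadratic) (hL : LocalWeilVHCAtCMQuadratic) :
    WeilClassesImaginaryQuadratic := by
  intro n hn d hd A φ hAdim hX hφ c hcQ hcH hc
  by_cases hc0 : c = 0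
  · rw [hc0]; exact Submodule.zero_mem _
  obtain ⟨𝒳, S, f, s₁, s₀, ι, W, hf, h𝒳, hS, hirrS, hsm, hW, hWeil, hread, A₀, ⟨e₀⟩, hA₀dim, hA₀cm⟩ :=
    hP n hn d hd A φ hAdim hX hφ c hcQ hcH hc hc0
  haveI := hirrS
  have hs₀ : complexBetti.map (fiberι f s₀) (2 * n) W ∈ algebraicClasses (fiberOver f s₀) n :=
    mem_algebraicClasses_of_cmChart hCM A₀ e₀ hA₀dim hA₀cm (hW s₀).1 (hW s₀).2
  obtain ⟨U, hU, hs₀U, hUalg⟩ :=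
    hL n hn d hd f hf h𝒳 hS hirrS hsm W hW hWeil s₀ ⟨A₀, ⟨e₀⟩, hA₀dim, hA₀cm⟩ hs₀
  have h1 : complexBetti.map (fiberι f s₁) (2 * n) W ∈ algebraicClasses (fiberOver f s₁) n :=
    mem_algebraicClasses_of_isOpen_subset_algebraicityLocus f h𝒳 hS hsm hf W hU ⟨s₀, hs₀U⟩ hUalg s₁
  rw [← hread]
  exact (mem_algebraicClasses_map_iff_of_iso ι).2 h1

/-! ### §4 Corollaries into ledger items (tree arrows of `Theorems/WeilTypeLadderOnPath.lean`) -/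

/-- stmt-HodgeConjecture-2522 (`TropicalCuspLift.WeilClassesAlgebraic`, also wanted by route HeckeOrbitCompactness)
from `HC_CM` + CM-pointed families + the local germ at CM fibres. [cite: Weil1977HodgeRing, pp. 421–429] -/
theorem HC_WeilClassesAlgebraic_of_HC_CM (hCM : Theses.RankFourFaces.CMAbelianHodge)
    (hP : CMPointedWeilFamiliesQuadratic) (hL : LocalWeilVHCAtCMQuadratic) :
    Theses.TropicalCuspLift.WeilClassesAlgebraic :=
  weilClassesAlgebraic_of_weilClassesImaginaryQuadratic (HC_WeilClassesQuadratic_of_HC_CM_local hCM hP hL)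

/-- ON-PATH (C6) for stmt-2522. [cite: Deligne2000, §1] -/
theorem HC_WeilClassesAlgebraic_of_HodgeConjecture (h : _root_.HodgeConjecture) :
    Theses.TropicalCuspLift.WeilClassesAlgebraic :=
  weilClassesAlgebraic_of_weilClassesImaginaryQuadratic (weilClassesImaginaryQuadratic_of_hodgeConjecture h)

/-- stmt-HodgeConjecture-2524 (`SevenfoldWeilCensus.WeilSixfolds`: Weil classes on abelian sixfolds of Weil type,
every `d`, every discriminant — the non-split sixfolds are OPEN in print) from `HC_CM` + CM-pointed families + the
local germ at CM fibres; ON-PATH lemma = tree `WeilTypeLadder.weilSixfolds_of_hodgeConjecture`.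
[cite: Markman2025SurveySecant, Thm. 1.2 and §11.5 (preprint / ICM 2026 lecture, unrefereed)] -/
theorem HC_WeilSixfolds_of_HC_CM (hCM : Theses.RankFourFaces.CMAbelianHodge)
    (hP : CMPointedWeilFamiliesQuadratic) (hL : LocalWeilVHCAtCMQuadratic) :
    Theses.SevenfoldWeilCensus.WeilSixfolds :=
  weilSixfolds_of_weilClassesImaginaryQuadratic (HC_WeilClassesQuadratic_of_HC_CM_local hCM hP hL)

/-- Rung R2 (`WeilTypeLadder.SplitWeilAbelianVarieties`, split Weil type, `n ≥ 4`) from the same three hypotheses;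
ON-PATH lemma = tree `WeilTypeLadder.splitWeilAbelianVarieties_of_hodgeConjecture`.
[cite: Markman2025SurveySecant, §12 (preprint / ICM 2026 lecture, unrefereed)] -/
theorem HC_SplitWeil_of_HC_CM (hCM : Theses.RankFourFaces.CMAbelianHodge)
    (hP : CMPointedWeilFamiliesQuadratic) (hL : LocalWeilVHCAtCMQuadratic) : SplitWeilAbelianVarieties :=
  splitWeilAbelianVarieties_of_weilClassesImaginaryQuadratic (HC_WeilClassesQuadratic_of_HC_CM_local hCM hP hL)

/-! ### §5 The conditional equivalence with André's theorem -/

/-- **Granted André 1992 (tree fact; direction Weil ⟹ CM only) and the four transport leaves, `HC_CM` is EQUIVALENT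
to the two top rungs R∞ ∧ R3 of the Weil-type ladder**: `→` by `HC_WeilClassesQuadratic_of_HC_CM` /
`HC_WeilClassesCMField_of_HC_CM`; `←` is the tree's André arrow `rankFourFaces_cmAbelianHodge_of_andre_of_rungs`
(which uses no transport hypothesis). [cite: Andre1992HodgeCM, Théorème]
[cite: Markman2025SurveySecant, Thm. 1.4 and §12 (preprint / ICM 2026 lecture, unrefereed)] -/
theorem HC_CM_iff_weilRungs_of_andre_of_transport
    (hA : Andre1992_hodgeClasses_cmAbelianVariety_mem_span_pullback_weilClasses)
    (hP₂ : CMPointedWeilFamiliesQuadratic) (hV₂ : WeilVariationalHodgeQuadratic)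
    (hP₃ : CMPointedWeilFamiliesCMField) (hV₃ : WeilVariationalHodgeCMField) :
    Theses.RankFourFaces.CMAbelianHodge ↔ WeilClassesImaginaryQuadratic ∧ WeilClassesCMField :=
  ⟨fun hCM ↦ ⟨HC_WeilClassesQuadratic_of_HC_CM hCM hP₂ hV₂, HC_WeilClassesCMField_of_HC_CM hCM hP₃ hV₃⟩,
    fun h ↦ rankFourFaces_cmAbelianHodge_of_andre_of_rungs hA h.1 h.2⟩

end Summit.HodgeConjecture.HodgeConjecture.Ring2Transport

end
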